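import Summits.AtomisticToContinuum.FouriersLaw.Theses.HonestZwanzig
import Summits.AtomisticToContinuum.FouriersLaw.Theorems.HonestZwanzigNetworkReductionBilinear
import Summits.AtomisticToContinuum.FouriersLaw.Theorems.HonestZwanzigNetworkReductionRobin
import Summits.AtomisticToContinuum.FouriersLaw.Theorems.HonestZwanzigGeneratorSiteEnergy

/-!
# `HonestZwanzig.RobinCoercivity` (crux stmt-AtomisticToContinuum-12695) — negative lemmas: the bath coupling is load-bearing

Refuter / crux-disprover support file (`--supports stmt-AtomisticToContinuum-12695`), UNCONDITIONAL.

* `RobinBody`, `RobinCoercivityAt`, `robinCoercivity_iff` — the crux's matrix inequality at fixed parameters / constant /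
  length / threshold, verbatim, and the definitional unfolding `RobinCoercivity ↔ ∀ params, ∃ c > 0, RobinCoercivityAt …`;
* `le_of_forall_small`, `sum_boundary_indicator` — bookkeeping shared with `…Negative.ContactCeiling`;
* `RobinCoercivityNonnegCoupling` — the crux with the hypothesis `0 < γ` weakened to `0 ≤ γ`;
* `robinCoercivity_false_without_coupling : ¬ RobinCoercivityNonnegCoupling` — **any proof of the crux must use `γ > 0`**.
  Witness `γ = 0`, `N = 2`, `ξ ≡ 1`: with no baths `L e_0 = −j_0 = −L e_1` (the two generator images are opposite), so by
  nothing more than `cov(f, −g) = −cov(f, g)` and `schur_s(±g, ∓g) = −schur_s(g, g)` the whole matrix sum collapses to the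
  static term, `1ᵀ𝔽_2(s)1 = s·1ᵀCov(e,e)1 → 0` (`sum_sum_feshbach_two_nocoupling`), while the Robin form of `ξ ≡ 1` is `2`;
  no integrability, invariance or positivity of `G(s)` is needed (pure sign bookkeeping at `N = 2`).
-/

noncomputable section

open MeasureTheory Finset Matrix
open Literature.MathematicalPhysics.KineticTheory.HeatConduction
open Summit.AtomisticToContinuum.FouriersLaw.Theses.HonestZwanzig
open Summit.AtomisticToContinuum.FouriersLaw.Theorems.HonestZwanzig
open Summit.AtomisticToContinuum.FouriersLaw.Theorems.HonestZwanzig.NetworkReduction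

namespace Summit.AtomisticToContinuum.FouriersLaw.Theorems.RobinCoercivity.Negative

/-! ### Elementary bookkeeping -/

/-- The Robin form of the constant profile has only the two contact terms: `Σ_i ([i=0] + [i=N−1]) = 2` (`N ≥ 2`). -/
theorem sum_boundary_indicator {N : ℕ} (hN : 2 ≤ N) :
    (∑ i : Fin N, ((if i.val = 0 then (1 : ℝ) else 0) + (if i.val = N - 1 then (1 : ℝ) else 0))) = 2 := by
  rw [Finset.sum_add_distrib, sum_ite_val_eq 0 (by omega) (fun _ => (1 : ℝ)),
    sum_ite_val_eq (N - 1) (by omega) (fun _ => (1 : ℝ))]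
  norm_num

/-- No room below a ceiling: if `a ≤ s·V + b` for all small `s > 0` then `a ≤ b`. -/
theorem le_of_forall_small {a b s₀ : ℝ} (hs₀ : 0 < s₀) (h : ∃ V : ℝ, ∀ s : ℝ, 0 < s → s < s₀ → a ≤ s * V + b) :
    a ≤ b := by
  obtain ⟨V, hV⟩ := h
  by_contra hlt
  push Not at hlt
  set ε : ℝ := a - b with hε
  have hε0 : 0 < ε := by rw [hε]; linarith
  set s : ℝ := min (s₀ / 2) (ε / (|V| + 1)) with hsdef
  have hs0 : 0 < s := lt_min (by linarith) (div_pos hε0 (by positivity))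
  have hs1 : s < s₀ := (min_le_left _ _).trans_lt (by linarith)
  have hs2 : s * |V| < ε := by
    have hle : s ≤ ε / (|V| + 1) := min_le_right _ _
    have hV0 : 0 ≤ |V| := abs_nonneg _
    calc s * |V| ≤ ε / (|V| + 1) * |V| := mul_le_mul_of_nonneg_right hle hV0
      _ < ε := by
        rw [div_mul_eq_mul_div, div_lt_iff₀ (by positivity)]
        nlinarith
  have h1 := hV s hs0 hs1
  have h3 : s * V ≤ s * |V| := mul_le_mul_of_nonneg_left (le_abs_self V) hs0.le
  linarith

/-! ### The crux at fixed parameters -/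

/-- The matrix inequality of `RobinCoercivity` at fixed parameters `(ω₂, lam, β, γ, T)`, constant `c`, length `N` and
Laplace threshold `s₀` — the crux's tail, verbatim. -/
def RobinBody (ω₂ lam β γ T c : ℝ) (N : ℕ) (s₀ : ℝ) : Prop :=
    let P := Literature.MathematicalPhysics.KineticTheory.HeatConduction.pinnedChain ω₂ lam β γ;
    let X := Literature.MathematicalPhysics.KineticTheory.HeatConduction.PhaseSpace N;
    let μ : MeasureTheory.Measure X := P.gibbsMeasure N T;
    let corr : (X → ℝ) → (X → ℝ) → ℝ → ℝ := fun f g t => (∫ z, f z * (∫ y, g y ∂(P.transitionKernel N T T t.toNNReal z)) ∂μ) - (∫ z, f z ∂μ) * (∫ z, g z ∂μ);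
    let lap : ℝ → (X → ℝ) → (X → ℝ) → ℝ := fun s f g => ∫ t in Set.Ioi (0 : ℝ), Real.exp (-(s * t)) * corr f g t;
    let cov : (X → ℝ) → (X → ℝ) → ℝ := fun f g => (∫ z, f z * g z ∂μ) - (∫ z, f z ∂μ) * (∫ z, g z ∂μ);
    let e : Fin N → X → ℝ := fun x z => z.2 x ^ 2 / 2 + P.U (z.1 x) + ∑ j : Fin N, ((if j.val = x.val + 1 then P.V (z.1 j - z.1 x) / 2 else 0) + (if x.val = j.val + 1 then P.V (z.1 x - z.1 j) / 2 else 0));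
    let G : ℝ → Matrix (Fin N) (Fin N) ℝ := fun s => Matrix.of fun x y => lap s (e x) (e y);
    let schur : ℝ → (X → ℝ) → (X → ℝ) → ℝ := fun s f g => lap s f g - ∑ x : Fin N, ∑ y : Fin N, lap s f (e x) * (G s)⁻¹ x y * lap s (e y) g;
    let F : ℝ → Fin N → Fin N → ℝ := fun s x y => s * cov (e x) (e y) - cov (e x) (P.generator N T T (e y)) - schur s (fun z => P.generator N T T (e x) (z.1, -z.2)) (P.generator N T T (e y));
    ∀ s : ℝ, 0 < s → s < s₀ → ∀ ξ : Fin N → ℝ, c * (∑ i : Fin N, ((∑ j : Fin N, if j.val = i.val + 1 then (ξ j - ξ i) ^ 2 else 0) + (if i.val = 0 then ξ i ^ 2 else 0) + (if i.val = N - 1 then ξ i ^ 2 else 0))) ≤ ∑ x : Fin N, ∑ y : Fin N, ξ x * F s x y * ξ y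

/-- `RobinCoercivity` at fixed parameters with a GIVEN constant `c`: for every `N ≥ 2` some threshold `s₀ > 0` works. -/
def RobinCoercivityAt (ω₂ lam β γ T c : ℝ) : Prop :=
  ∀ N : ℕ, 2 ≤ N → ∃ s₀ : ℝ, 0 < s₀ ∧ RobinBody ω₂ lam β γ T c N s₀

/-- The crux is, definitionally, "for all positive parameters some positive constant is admissible". -/
theorem robinCoercivity_iff :
    RobinCoercivity ↔ ∀ ω₂ lam β γ : ℝ, 0 < ω₂ → 0 < lam → 0 < β → 0 < γ → ∀ T : ℝ, 0 < T →
      ∃ c : ℝ, 0 < c ∧ RobinCoercivityAt ω₂ lam β γ T c :=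
  Iff.rfl

/-! ### Two sites, no baths: the Feshbach matrix sums to its static part -/

section TwoSites

variable {ω₂ lam β : ℝ} {T : ℝ}
  {corr : (PhaseSpace 2 → ℝ) → (PhaseSpace 2 → ℝ) → ℝ → ℝ}
  {lap : ℝ → (PhaseSpace 2 → ℝ) → (PhaseSpace 2 → ℝ) → ℝ}
  {cov : (PhaseSpace 2 → ℝ) → (PhaseSpace 2 → ℝ) → ℝ}
  {e : Fin 2 → PhaseSpace 2 → ℝ}
  (hcorr : ∀ f g t, corr f g t =
    (∫ z, f z * (∫ y, g y ∂((pinnedChain ω₂ lam β 0).transitionKernel 2 T T t.toNNReal z))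
      ∂(pinnedChain ω₂ lam β 0).gibbsMeasure 2 T) -
    (∫ z, f z ∂(pinnedChain ω₂ lam β 0).gibbsMeasure 2 T) *
      (∫ z, g z ∂(pinnedChain ω₂ lam β 0).gibbsMeasure 2 T))
  (hlap : ∀ s f g, lap s f g = ∫ t in Set.Ioi (0 : ℝ), Real.exp (-(s * t)) * corr f g t)
  (hcov : ∀ f g, cov f g = (∫ z, f z * g z ∂(pinnedChain ω₂ lam β 0).gibbsMeasure 2 T) -
    (∫ z, f z ∂(pinnedChain ω₂ lam β 0).gibbsMeasure 2 T) *
      (∫ z, g z ∂(pinnedChain ω₂ lam β 0).gibbsMeasure 2 T))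
  (hGSE : ∀ (x : Fin 2) (z : PhaseSpace 2), (pinnedChain ω₂ lam β 0).generator 2 T T (e x) z =
    (∑ b : Fin 2, ((if x.val = b.val + 1 then (pinnedChain ω₂ lam β 0).bondCurrent 2 b z else 0) -
      (if b = x then (pinnedChain ω₂ lam β 0).bondCurrent 2 b z else 0))) +
    (if x.val = 0 then (pinnedChain ω₂ lam β 0).γ * (T - z.2 x ^ 2) else 0) +
    (if x.val = 2 - 1 then (pinnedChain ω₂ lam β 0).γ * (T - z.2 x ^ 2) else 0))

include hcov in
/-- `cov(f, −g) = −cov(f, g)` (no integrability needed). -/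
theorem cov_neg_right (f g : PhaseSpace 2 → ℝ) : cov f (fun z => -g z) = -cov f g := by
  rw [hcov, hcov]
  have h1 : (fun z => f z * -g z) = fun z => -(f z * g z) := funext fun z => by ring
  rw [h1, integral_neg, integral_neg]
  ring

include hcorr hlap in
/-- `schur_s(f, c·g) = c·schur_s(f, g)` for the Schur pairing built on `lap_s` (no integrability needed). -/
theorem schur_const_mul_right (s : ℝ) (G : Matrix (Fin 2) (Fin 2) ℝ)
    (schur : (PhaseSpace 2 → ℝ) → (PhaseSpace 2 → ℝ) → ℝ)
    (hschur : ∀ f g, schur f g = lap s f g - ∑ u, ∑ v, lap s f (e u) * G⁻¹ u v * lap s (e v) g)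
    (c : ℝ) (f g : PhaseSpace 2 → ℝ) : schur f (fun z => c * g z) = c * schur f g := by
  rw [hschur, hschur]
  simp only [lap_const_mul_right hcorr hlap, mul_sub, Finset.mul_sum]
  congr 1
  exact Finset.sum_congr rfl fun u _ => Finset.sum_congr rfl fun v _ => by ring

include hcorr hlap in
/-- `schur_s(c·f, g) = c·schur_s(f, g)`. -/
theorem schur_const_mul_left (s : ℝ) (G : Matrix (Fin 2) (Fin 2) ℝ)
    (schur : (PhaseSpace 2 → ℝ) → (PhaseSpace 2 → ℝ) → ℝ)
    (hschur : ∀ f g, schur f g = lap s f g - ∑ u, ∑ v, lap s f (e u) * G⁻¹ u v * lap s (e v) g)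
    (c : ℝ) (f g : PhaseSpace 2 → ℝ) : schur (fun z => c * f z) g = c * schur f g := by
  rw [hschur, hschur]
  simp only [lap_const_mul_left hcorr hlap, mul_sub, Finset.mul_sum]
  congr 1
  exact Finset.sum_congr rfl fun u _ => Finset.sum_congr rfl fun v _ => by ring

include hcorr hlap in
/-- `schur_s(f, −g) = −schur_s(f, g)`. -/
theorem schur_neg_right (s : ℝ) (G : Matrix (Fin 2) (Fin 2) ℝ)
    (schur : (PhaseSpace 2 → ℝ) → (PhaseSpace 2 → ℝ) → ℝ)
    (hschur : ∀ f g, schur f g = lap s f g - ∑ u, ∑ v, lap s f (e u) * G⁻¹ u v * lap s (e v) g)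
    (f g : PhaseSpace 2 → ℝ) : schur f (fun z => -g z) = -schur f g := by
  rw [show (fun z => -g z) = (fun z => (-1 : ℝ) * g z) from funext fun z => by ring,
    schur_const_mul_right hcorr hlap s G schur hschur]
  ring

include hcorr hlap in
/-- `schur_s(−f, g) = −schur_s(f, g)`. -/
theorem schur_neg_left (s : ℝ) (G : Matrix (Fin 2) (Fin 2) ℝ)
    (schur : (PhaseSpace 2 → ℝ) → (PhaseSpace 2 → ℝ) → ℝ)
    (hschur : ∀ f g, schur f g = lap s f g - ∑ u, ∑ v, lap s f (e u) * G⁻¹ u v * lap s (e v) g)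
    (f g : PhaseSpace 2 → ℝ) : schur (fun z => -f z) g = -schur f g := by
  rw [show (fun z => -f z) = (fun z => (-1 : ℝ) * f z) from funext fun z => by ring,
    schur_const_mul_left hcorr hlap s G schur hschur]
  ring

include hGSE in
/-- With no baths the generator images of the two split site energies are opposite bond currents:
`L e_0 = −j_0`, `L e_1 = +j_0` (`j_1 ≡ 0`). -/
theorem generator_splitSite_two_nocoupling :
    (pinnedChain ω₂ lam β 0).generator 2 T T (e 0) = (fun z => -(pinnedChain ω₂ lam β 0).bondCurrent 2 0 z) ∧
    (pinnedChain ω₂ lam β 0).generator 2 T T (e 1) = (pinnedChain ω₂ lam β 0).bondCurrent 2 0 := by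
  have hγ0 : (pinnedChain ω₂ lam β 0).γ = 0 := rfl
  have hj1 : ∀ z, (pinnedChain ω₂ lam β 0).bondCurrent 2 1 z = 0 := fun z =>
    bondCurrent_eq_zero_of_last _ 1 (by decide) z
  refine ⟨funext fun z => ?_, funext fun z => ?_⟩
  · rw [hGSE]
    simp [hγ0]
  · rw [hGSE]
    simp [hγ0, hj1]

include hcorr hlap hcov hGSE in
/-- **Two sites, no baths**: `Σ_x Σ_y 𝔽_2(s)_{xy} = s·Σ_x Σ_y Cov(e_x, e_y)` — the contact and memory blocks cancel in
pairs because `L e_0 = −L e_1` and `L†e_0 = −L†e_1`. -/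
theorem sum_sum_feshbach_two_nocoupling (s : ℝ) (G : Matrix (Fin 2) (Fin 2) ℝ)
    (schur : (PhaseSpace 2 → ℝ) → (PhaseSpace 2 → ℝ) → ℝ)
    (hschur : ∀ f g, schur f g = lap s f g - ∑ u, ∑ v, lap s f (e u) * G⁻¹ u v * lap s (e v) g)
    (F : Fin 2 → Fin 2 → ℝ)
    (hF : ∀ x y, F x y = s * cov (e x) (e y) - cov (e x) ((pinnedChain ω₂ lam β 0).generator 2 T T (e y)) -
      schur (fun z => (pinnedChain ω₂ lam β 0).generator 2 T T (e x) (z.1, -z.2))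
        ((pinnedChain ω₂ lam β 0).generator 2 T T (e y))) :
    ∑ x, ∑ y, F x y = s * ∑ x, ∑ y, cov (e x) (e y) := by
  obtain ⟨h0, h1⟩ := generator_splitSite_two_nocoupling hGSE
  simp only [Fin.sum_univ_two, hF]
  rw [h0, h1]
  simp only [OscillatorChain.bondCurrent_neg_momentum, neg_neg, cov_neg_right hcov,
    schur_neg_right hcorr hlap s G schur hschur, schur_neg_left hcorr hlap s G schur hschur]
  ring

end TwoSites

/-! ### The coupling is load-bearing -/

/-- The crux with the bath coupling allowed to vanish: `0 < γ` weakened to `0 ≤ γ`, everything else verbatim. -/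
def RobinCoercivityNonnegCoupling : Prop :=
  ∀ ω₂ lam β γ : ℝ, 0 < ω₂ → 0 < lam → 0 < β → 0 ≤ γ → ∀ T : ℝ, 0 < T →
    ∃ c : ℝ, 0 < c ∧ RobinCoercivityAt ω₂ lam β γ T c

/-- **`RobinCoercivity` is false without `γ > 0`** (any proof must use the bath coupling): at `γ = 0`, `N = 2` the
Feshbach matrix sums to `s·1ᵀCov(e,e)1 → 0` against the constant profile, whose Robin form is `2`. Unconditional:
pure sign bookkeeping, `sum_sum_feshbach_two_nocoupling`. -/
theorem robinCoercivity_false_without_coupling : ¬ RobinCoercivityNonnegCoupling := by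
  intro h
  obtain ⟨c, hc, hAt⟩ := h 1 1 1 0 one_pos one_pos one_pos le_rfl 1 one_pos
  obtain ⟨s₀, hs₀, hbody⟩ := hAt 2 le_rfl
  dsimp only [RobinBody] at hbody
  have h2c : 2 * c ≤ 0 := by
    have h := le_of_forall_small (b := 0) hs₀ ⟨_, fun s hs hss => by
      have h1 := hbody s hs hss (fun _ => 1)
      simp only [sub_self, ne_eq, OfNat.ofNat_ne_zero, not_false_eq_true, zero_pow, ite_self,
        Finset.sum_const_zero, zero_add, one_pow, one_mul, mul_one] at h1
      rw [sum_boundary_indicator (le_refl 2), mul_comm] at h1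
      rw [add_zero]
      exact h1.trans_eq (sum_sum_feshbach_two_nocoupling (ω₂ := 1) (lam := 1) (β := 1) (T := 1)
        (corr := fun f g t => (∫ z, f z * (∫ y, g y ∂((pinnedChain 1 1 1 0).transitionKernel 2 1 1
          t.toNNReal z)) ∂(pinnedChain 1 1 1 0).gibbsMeasure 2 1) -
          (∫ z, f z ∂(pinnedChain 1 1 1 0).gibbsMeasure 2 1) * (∫ z, g z ∂(pinnedChain 1 1 1 0).gibbsMeasure 2 1))
        (cov := fun f g => (∫ z, f z * g z ∂(pinnedChain 1 1 1 0).gibbsMeasure 2 1) -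
          (∫ z, f z ∂(pinnedChain 1 1 1 0).gibbsMeasure 2 1) * (∫ z, g z ∂(pinnedChain 1 1 1 0).gibbsMeasure 2 1))
        (fun f g t => rfl) (fun s f g => rfl) (fun f g => rfl)
        (fun x z => generatorSiteEnergy_proof 1 1 1 0 2 le_rfl 1 1 x z) s _ _ (fun f g => rfl) _ (fun x y => rfl))⟩
    exact h
  linarith

end Summit.AtomisticToContinuum.FouriersLaw.Theorems.RobinCoercivity.Negative

end
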